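import Summits.BirchSwinnertonDyer.BirchSwinnertonDyer.Theorems.ErratumRoadFiveNonSurjCornerKolyJProp44Choice
import Summits.BirchSwinnertonDyer.BirchSwinnertonDyer.Theorems.Rank1ResidualJetCompatibleData
import Literature.NumberTheory.EllipticCurves.HeegnerPointsOfConductorRationalityProofs
import HarnessLib

/-!
# McCallum Prop. 4.4 «in particular» at Zhang–Kolyvagin levels for ANY two Kolyvagin–Heegner data (NO compatibility
# binders), on the irreducible cell, modulo (γ) — the currency of the swap's `h44c` (arbitrary families) and of the
# walk's `h47` with no based-family construction (cell `bsd-stepL`, seat `bsd-stepL-corner-p1` g10;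
# `--supports stmt-BirchSwinnertonDyer-19947`; memo CORNER-G10 §3)

WHY/WHAT. The typed print fact `McCallum1991.prop44_localOrder_kolyvaginClass_mul_eq` and this seat's kernel
`Prop44.localOrder_kolyvaginClass_mul_eq_of_congruence_of_irr` compare the classes of two data `d` (conductor `m`) and
`d'` (conductor `mℓ`) that are COMPATIBLE (McCallum's one system of choices: `hσ`, `hS₁`, `hS₂`, `hemb`). The swap supply
of the corner reading (`Koly.nonSurjCornerKolyJ_max_of_levelOneSupply_of_perLevel`, its `h44c`) quantifies over
ARBITRARY families of data. Since the class `c_M(n)` of a datum depends on its auxiliary choices only up to a unit of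
`ℤ/p^M` (`Prop44.zsmul_kolyvaginClass_mem_iff_of_sameLevel`, x11b3's choice-independence at a Zhang level), and a datum
compatible with any given `d` exists at `mℓ` (bsd-jet's `exists_compatible_data_of_grossCM` on the PROVED Gross §3
rationality `phi_heegnerPointOfConductor_mem_range_map_ringClassField_holds`), the compatibility binders can be DROPPED:
`localOrder_kolyvaginClass_mul_eq_of_irr`, `addOrderOf_localization_kolyvaginClass_mul_eq_of_irr` (h47),
`kolyvaginClass_mul_mem_torsionLocalKer_iff_of_irr` (h44c) hold for ANY `d`, `d'` — modulo (γ) for the pairs at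
`(mℓ, m)` (hypothesis `hγ`, the body of Gross Prop. 3.7 (2) in pair form; image-free print). HONEST FRAMING: conditional
on (γ); nothing about BSD; no stub closes; T7. References: [McCallumLMS1991] §4 Prop. 4.4, (4)–(6); [GrossLMS1991] §3,
§4 (4.1) and the sentence after it, Prop. 3.6, Prop. 3.7 (2), Lemma 4.3; [Jetchev2008] Prop. 4.4 (p. 821);
[WZhang2014] Notations (xii).
-/

set_option autoImplicit false
set_option linter.dupNamespace false

noncomputable section

open scoped Classical
open WeierstrassCurve Field NumberField IsDedekindDomain Finset
open Literature.NumberTheory.EllipticCurves Literature.NumberTheory.GaloisRepresentations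
open Literature.NumberTheory.EllipticCurves.KolyvaginCocycle
open Literature.NumberTheory.EllipticCurves.RingClassField
open Literature.NumberTheory.EllipticCurves.ModularForms
open Literature.NumberTheory.GaloisCohomology
open Summit.BirchSwinnertonDyer.Rank1Residual.X11b
open Summit.BirchSwinnertonDyer.Rank1Residual.JET

namespace Summit.BirchSwinnertonDyer.BirchSwinnertonDyer.Theorems.Prop44

-- `K : Type`: the tree's ring-class class field theory is universe `0`.
variable {K : Type} [Field K] [NumberField K] {W : WeierstrassCurve ℚ} [W.IsElliptic] [W.IsGloballyMinimal]
  [NeZero (W.conductorNorm ℤ)]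

/-- **McCallum Prop. 4.4 «in particular» for ANY two data at conductors `m`, `mℓ` (no compatibility), `E[p]` irreducible,
modulo (γ).** `K` imaginary quadratic (`d_K ∉ {−3,−4}`, Heegner hypothesis for `N_E`), `p` odd split in `K`, `E[p]`
irreducible, `M ≥ 1`, `mℓ` square-free with Zhang–Kolyvagin prime factors of index `≥ M`, ANY `d : KolyvaginHeegnerData
Dt β ι m`, `d' : KolyvaginHeegnerData Dt β ι (m * ℓ)`, and (γ) = Gross Prop. 3.7 (2) for the data pairs at `(mℓ, m)`
(`hγ`): at `λ ∋ ℓ`, for every `j`, `p^j c_M(mℓ) ∈ Sel_λ ↔ p^j c_M(mℓ)_λ = 0` and `p^j c_M(mℓ)_λ = 0 ↔ p^j c_M(m)_λ = 0`.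
[cite: McCallumLMS1991, §4 Prop. 4.4 (p. 301)] [cite: GrossLMS1991, §4 (4.1), Prop. 3.7 (2)] [cite: WZhang2014,
Notations (xii)] -/
theorem localOrder_kolyvaginClass_mul_eq_of_irr (hK : IsImaginaryQuadratic K)
    (hD3 : NumberField.discr K ≠ -3) (hD4 : NumberField.discr K ≠ -4)
    (hH : SatisfiesHeegnerHypothesis (W.conductorNorm ℤ) K) {p : ℕ} [Fact p.Prime] (hp2 : p ≠ 2)
    (hHp : SatisfiesHeegnerHypothesis p K) (hirr : W.HasIrreducibleModPGaloisRep p)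
    (Dt : ModularParametrizationData W (W.conductorNorm ℤ)) (β : ℤ) (ι : K →+* ℂ) (M : ℕ) (hM : 1 ≤ M)
    (m l : ℕ) (hsq : Squarefree (m * l)) (hl : l.Prime) (hlm : ¬ l ∣ m)
    (hS : ∀ l' ∈ (m * l).primeFactors, Zhang2014.IsKolyvaginPrime (W.conductorNorm ℤ) W K p l' ∧
      M ≤ Zhang2014.kolyvaginIndex W p l')
    (d : KolyvaginHeegnerData Dt β ι m) (d' : KolyvaginHeegnerData Dt β ι (m * l))
    (hγ : ∀ (d₁ : KolyvaginHeegnerData Dt β ι (m * l)) (d₀ : KolyvaginHeegnerData Dt β ι m)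
      [Fact l.Prime] (hΔ : ¬ (l : ℤ) ∣ minimalDiscriminantInt W)
      (φ₀ : absoluteGaloisGroup (ZMod l)), (∀ x : AlgebraicClosure (ZMod l), φ₀ • x = x ^ l) →
      ∀ (hle : ringClassField K ι m ≤ ringClassField K ι (m * l))
        (γ : ringClassField K ι (m * l) ≃ₐ[ℚ] ringClassField K ι (m * l)), γ ∈ ringClassGal ι (m * l) →
        geomReduction hΔ ((RatClosure.pointsEquiv (K := K) W).symm
            (d₁.toGeomPoints (pointGalHom W (ringClassField K ι (m * l)) γ d₁.y))) =
          φ₀ • geomReduction hΔ ((RatClosure.pointsEquiv (K := K) W).symm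
            (d₁.toGeomPoints (pointGalHom W (ringClassField K ι (m * l)) γ
              (WeierstrassCurve.Affine.Point.map (W' := W)
                (letI : Algebra K ℂ := ι.toAlgebra; (RingClassField.inclusion ι hle).restrictScalars ℚ)
                d₀.y)))))
    (v : HeightOneSpectrum (𝓞 K)) (hv : (l : 𝓞 K) ∈ v.asIdeal) (j : ℕ) :
    (((p ^ j : ℕ) : ℤ) • d'.kolyvaginClass (Fact.out : p.Prime) M ∈
        selmerLocalKer (W.baseChange K) (v.adicCompletion K) ((p ^ M : ℕ) : ℤ) ↔
      ((p ^ j : ℕ) : ℤ) • d'.kolyvaginClass (Fact.out : p.Prime) M ∈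
        (W.baseChange K).torsionLocalKer (v.adicCompletion K) ((p ^ M : ℕ) : ℤ)) ∧
    (((p ^ j : ℕ) : ℤ) • d'.kolyvaginClass (Fact.out : p.Prime) M ∈
        (W.baseChange K).torsionLocalKer (v.adicCompletion K) ((p ^ M : ℕ) : ℤ) ↔
      ((p ^ j : ℕ) : ℤ) • d.kolyvaginClass (Fact.out : p.Prime) M ∈
        (W.baseChange K).torsionLocalKer (v.adicCompletion K) ((p ^ M : ℕ) : ℤ)) := by
  have hp : p.Prime := Fact.out
  have hD : NumberField.discr K < -4 := KolyvaginAssembly.discr_lt_neg_four hK ⟨hD3, hD4⟩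
  have hn0 : m * l ≠ 0 := hsq.ne_zero
  have hm : Squarefree m := hsq.squarefree_of_dvd (dvd_mul_right m l)
  have hSm : ∀ q ∈ m.primeFactors, Zhang2014.IsKolyvaginPrime (W.conductorNorm ℤ) W K p q ∧
      M ≤ Zhang2014.kolyvaginIndex W p q :=
    fun q hq ↦ hS q (Nat.primeFactors_mono (dvd_mul_right m l) hn0 hq)
  have hKol : Zhang2014.IsKolyvaginPrime (W.conductorNorm ℤ) W K p l :=
    (hS l (Nat.mem_primeFactors.mpr ⟨hl, dvd_mul_left l m, hn0⟩)).1
  have hlc : l ∉ m.primeFactors := fun h ↦ hlm (Nat.dvd_of_mem_primeFactors h)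
  have hpml : ¬ p ∣ m * l := fun h ↦
    (hS p (Nat.mem_primeFactors.mpr ⟨hp, h, hn0⟩)).1.2.2.2.1 rfl
  have hKunr : ∀ v : HeightOneSpectrum (𝓞 ℚ), (p : 𝓞 ℚ) ∈ v.asIdeal →
      Algebra.IsUnramifiedIn (𝓞 K) v.asIdeal :=
    isUnramifiedIn_of_satisfiesHeegnerHypothesis_of_dvd hK hHp hp (dvd_refl p)
  -- a datum at `mℓ` COMPATIBLE with `d` (Gross's one system of choices)
  obtain ⟨dℓ, hdℓ⟩ := exists_compatible_data_of_grossCM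
    (phi_heegnerPointOfConductor_mem_range_map_ringClassField_holds _ W K) hK hD hH p Dt β ι hm
    (fun q hq ↦ (hSm q hq).1) d
  set d'' : KolyvaginHeegnerData Dt β ι (m * l) := dℓ l hKol hlc with hd''
  obtain ⟨hσ, hS₁, hS₂, hemb⟩ := hdℓ l hKol hlc
  -- Prop. 4.4 for the compatible pair `(d, d'')`
  have h := localOrder_kolyvaginClass_mul_eq_of_congruence_of_irr hK hD3 hD4 hH hp2 hHp hirr Dt β ι M hM m l hsq
    hl hlm hS d d'' hσ hS₁ hS₂ hemb (fun hΔ φ₀ hφ₀ hle γ hγ' ↦ hγ d'' d hΔ φ₀ hφ₀ hle γ hγ') v hv j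
  -- `d'` and `d''` have classes differing by a unit (choice independence at the Zhang level `mℓ`)
  have hA'' : IsAdmissible (absoluteGaloisGroup K) d''.pointsSubgroup ((p ^ M : ℕ) : ℤ) :=
    NoTorsionIrr.isAdmissible_pointsSubgroup_of_hasIrreducibleModPGaloisRep d'' hK hn0 hp hp2 hirr
      (W.exists_weilPairing_holds p) hKunr hpml M
  have hsw : ∀ H : AddSubgroup (galH1Torsion (W.baseChange K) ((p ^ M : ℕ) : ℤ)),
      ((p ^ j : ℕ) : ℤ) • d'.kolyvaginClass hp M ∈ H ↔ ((p ^ j : ℕ) : ℤ) • d''.kolyvaginClass hp M ∈ H :=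
    fun H ↦ zsmul_kolyvaginClass_mem_iff_of_sameLevel hK ι hD hH Dt hp hM hsq hS d'' d' hA'' H _
  exact ⟨(hsw _).trans (h.1.trans (hsw _).symm), (hsw _).trans h.2⟩

/-- **The walk's `h47` currency for ANY two data** — `addOrderOf (loc_λ c_M(mℓ)) = addOrderOf (loc_λ c_M(m))`, no
compatibility, `E[p]` irreducible, modulo (γ) for the pairs at `(mℓ, m)`. [cite: Jetchev2008, Prop. 4.4 (p. 821)]
[cite: McCallumLMS1991, §4 Prop. 4.4 (p. 301)] [cite: GrossLMS1991, Prop. 3.7 (2), §4 (4.1)] -/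
theorem addOrderOf_localization_kolyvaginClass_mul_eq_of_irr (hK : IsImaginaryQuadratic K)
    (hD3 : NumberField.discr K ≠ -3) (hD4 : NumberField.discr K ≠ -4)
    (hH : SatisfiesHeegnerHypothesis (W.conductorNorm ℤ) K) {p : ℕ} [Fact p.Prime] (hp2 : p ≠ 2)
    (hHp : SatisfiesHeegnerHypothesis p K) (hirr : W.HasIrreducibleModPGaloisRep p)
    (Dt : ModularParametrizationData W (W.conductorNorm ℤ)) (β : ℤ) (ι : K →+* ℂ) (M : ℕ) (hM : 1 ≤ M)
    (m l : ℕ) (hsq : Squarefree (m * l)) (hl : l.Prime) (hlm : ¬ l ∣ m)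
    (hS : ∀ l' ∈ (m * l).primeFactors, Zhang2014.IsKolyvaginPrime (W.conductorNorm ℤ) W K p l' ∧
      M ≤ Zhang2014.kolyvaginIndex W p l')
    (d : KolyvaginHeegnerData Dt β ι m) (d' : KolyvaginHeegnerData Dt β ι (m * l))
    (hγ : ∀ (d₁ : KolyvaginHeegnerData Dt β ι (m * l)) (d₀ : KolyvaginHeegnerData Dt β ι m)
      [Fact l.Prime] (hΔ : ¬ (l : ℤ) ∣ minimalDiscriminantInt W)
      (φ₀ : absoluteGaloisGroup (ZMod l)), (∀ x : AlgebraicClosure (ZMod l), φ₀ • x = x ^ l) →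
      ∀ (hle : ringClassField K ι m ≤ ringClassField K ι (m * l))
        (γ : ringClassField K ι (m * l) ≃ₐ[ℚ] ringClassField K ι (m * l)), γ ∈ ringClassGal ι (m * l) →
        geomReduction hΔ ((RatClosure.pointsEquiv (K := K) W).symm
            (d₁.toGeomPoints (pointGalHom W (ringClassField K ι (m * l)) γ d₁.y))) =
          φ₀ • geomReduction hΔ ((RatClosure.pointsEquiv (K := K) W).symm
            (d₁.toGeomPoints (pointGalHom W (ringClassField K ι (m * l)) γ
              (WeierstrassCurve.Affine.Point.map (W' := W)
                (letI : Algebra K ℂ := ι.toAlgebra; (RingClassField.inclusion ι hle).restrictScalars ℚ)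
                d₀.y)))))
    (v : HeightOneSpectrum (𝓞 K)) (hv : (l : 𝓞 K) ∈ v.asIdeal) :
    addOrderOf ((galoisCohomology.localization
        ((W.baseChange K).torsionGaloisModule ((p ^ M : ℕ) : ℤ)) (Sum.inr v) 1 :
          galH1Torsion (W.baseChange K) ((p ^ M : ℕ) : ℤ) →+ _)
        (d'.kolyvaginClass (Fact.out : p.Prime) M)) =
      addOrderOf ((galoisCohomology.localization
        ((W.baseChange K).torsionGaloisModule ((p ^ M : ℕ) : ℤ)) (Sum.inr v) 1 :
          galH1Torsion (W.baseChange K) ((p ^ M : ℕ) : ℤ) →+ _)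
        (d.kolyvaginClass (Fact.out : p.Prime) M)) := by
  have hp : p.Prime := Fact.out
  set loc : galH1Torsion (W.baseChange K) ((p ^ M : ℕ) : ℤ) →+
      galoisCohomology (((W.baseChange K).torsionGaloisModule ((p ^ M : ℕ) : ℤ)).toLocal (Sum.inr v)) 1 :=
    galoisCohomology.localization ((W.baseChange K).torsionGaloisModule ((p ^ M : ℕ) : ℤ)) (Sum.inr v) 1
    with hlocdef
  have hloc : ∀ (z : galH1Torsion (W.baseChange K) ((p ^ M : ℕ) : ℤ)) (j : ℕ), loc (p ^ j • z) = 0 ↔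
      ((p ^ j : ℕ) : ℤ) • z ∈ (W.baseChange K).torsionLocalKer (v.adicCompletion K) ((p ^ M : ℕ) : ℤ) := by
    intro z j
    haveI : CharZero (v.adicCompletion K) := charZero_of_injective_algebraMap (algebraMap K _).injective
    rw [hlocdef, natCast_zsmul, mem_torsionLocalKer_iff_res_eq_zero (W := W.baseChange K)
      (E := v.adicCompletion K) (pow_ne_zero M hp.ne_zero)]
    exact Iff.rfl
  have hkillL : ∀ z : galH1Torsion (W.baseChange K) ((p ^ M : ℕ) : ℤ), p ^ M • loc z = 0 := fun z ↦
    galoisCohomology.nsmul_eq_zero_of_forall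
      (((W.baseChange K).torsionGaloisModule ((p ^ M : ℕ) : ℤ)).toLocal (Sum.inr v))
      (fun T ↦ by
        have h := (W.baseChange K).natAbs_nsmul_geomTorsion T
        rwa [Int.natAbs_natCast] at h) (loc z)
  have h := localOrder_kolyvaginClass_mul_eq_of_irr hK hD3 hD4 hH hp2 hHp hirr Dt β ι M hM m l hsq hl hlm hS d d'
    hγ v hv
  refine addOrderOf_eq_addOrderOf_of_forall_nsmul_eq_zero_iff hp (hkillL _) (hkillL _) fun j ↦ ?_
  rw [← map_nsmul, ← map_nsmul]
  exact (hloc _ j).trans ((h j).2.trans (hloc _ j).symm)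

/-- **The swap's `h44c` currency for ANY two data (`j = 0`)** — `c_M(mℓ)_λ = 0 ↔ c_M(m)_λ = 0`, no compatibility, `E[p]`
irreducible, modulo (γ). [cite: McCallumLMS1991, §4 Prop. 4.4 (p. 301)] [cite: GrossLMS1991, Prop. 6.2 (2), Prop. 3.7 (2)] -/
theorem kolyvaginClass_mul_mem_torsionLocalKer_iff_of_irr (hK : IsImaginaryQuadratic K)
    (hD3 : NumberField.discr K ≠ -3) (hD4 : NumberField.discr K ≠ -4)
    (hH : SatisfiesHeegnerHypothesis (W.conductorNorm ℤ) K) {p : ℕ} [Fact p.Prime] (hp2 : p ≠ 2)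
    (hHp : SatisfiesHeegnerHypothesis p K) (hirr : W.HasIrreducibleModPGaloisRep p)
    (Dt : ModularParametrizationData W (W.conductorNorm ℤ)) (β : ℤ) (ι : K →+* ℂ) (M : ℕ) (hM : 1 ≤ M)
    (m l : ℕ) (hsq : Squarefree (m * l)) (hl : l.Prime) (hlm : ¬ l ∣ m)
    (hS : ∀ l' ∈ (m * l).primeFactors, Zhang2014.IsKolyvaginPrime (W.conductorNorm ℤ) W K p l' ∧
      M ≤ Zhang2014.kolyvaginIndex W p l')
    (d : KolyvaginHeegnerData Dt β ι m) (d' : KolyvaginHeegnerData Dt β ι (m * l))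
    (hγ : ∀ (d₁ : KolyvaginHeegnerData Dt β ι (m * l)) (d₀ : KolyvaginHeegnerData Dt β ι m)
      [Fact l.Prime] (hΔ : ¬ (l : ℤ) ∣ minimalDiscriminantInt W)
      (φ₀ : absoluteGaloisGroup (ZMod l)), (∀ x : AlgebraicClosure (ZMod l), φ₀ • x = x ^ l) →
      ∀ (hle : ringClassField K ι m ≤ ringClassField K ι (m * l))
        (γ : ringClassField K ι (m * l) ≃ₐ[ℚ] ringClassField K ι (m * l)), γ ∈ ringClassGal ι (m * l) →
        geomReduction hΔ ((RatClosure.pointsEquiv (K := K) W).symm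
            (d₁.toGeomPoints (pointGalHom W (ringClassField K ι (m * l)) γ d₁.y))) =
          φ₀ • geomReduction hΔ ((RatClosure.pointsEquiv (K := K) W).symm
            (d₁.toGeomPoints (pointGalHom W (ringClassField K ι (m * l)) γ
              (WeierstrassCurve.Affine.Point.map (W' := W)
                (letI : Algebra K ℂ := ι.toAlgebra; (RingClassField.inclusion ι hle).restrictScalars ℚ)
                d₀.y)))))
    (v : HeightOneSpectrum (𝓞 K)) (hv : (l : 𝓞 K) ∈ v.asIdeal) :
    d'.kolyvaginClass (Fact.out : p.Prime) M ∈
        (W.baseChange K).torsionLocalKer (v.adicCompletion K) ((p ^ M : ℕ) : ℤ) ↔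
      d.kolyvaginClass (Fact.out : p.Prime) M ∈
        (W.baseChange K).torsionLocalKer (v.adicCompletion K) ((p ^ M : ℕ) : ℤ) := by
  have h := (localOrder_kolyvaginClass_mul_eq_of_irr hK hD3 hD4 hH hp2 hHp hirr Dt β ι M hM m l hsq hl hlm hS d d'
    hγ v hv 0).2
  simp only [pow_zero, Nat.cast_one, one_zsmul] at h
  exact h

end Summit.BirchSwinnertonDyer.BirchSwinnertonDyer.Theorems.Prop44

end
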